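import Summits.RiemannHypothesis.RiemannHypothesis.Theorems.TiltedLandingLaw421R3QuadW

/-!
# LateralPurse — W-08 · C4 «kernel desk» · rh-idea-6 g27 (answer to director (CA358)(a), RATE^B «what pays for an unpaid charged level?»)

The kernel fact behind the `(Hs/s)²` term of LAW 421's purse: along a NESTED lineage `v₀ → v₁ → … → v_K` (each step `NestedStep (v k) (v (k+1))`, i.e.
`(Re v_{k+1} − Re v_k)² + (Im v_{k+1})² ≤ (Im v_k)²` — the closed Jensen disc), LATERAL MOTION IS PAID BY HEIGHT²:
`Σ_{k<K} (Re v_{k+1} − Re v_k)² + (Im v_K)² ≤ (Im v₀)²`  (`lateral_sq_sum_le`), hence `Σ_{k<K} Δ_k² ≤ Hs²` for a lineage born at height `≤ Hs`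
(`lateral_sq_sum_le_sq`), and every level with a lateral step `|Δ_k| ≥ s` costs `s²` of that purse: `s² · #{k < K : s ≤ |Δ_k|} ≤ (Im v₀)²` (`card_big_steps_le`).
This is the LATERAL METER; it is not in the RATE text (`RhW08.SealSwapQ.RestRateBotQ`), whose only slack is the `k = 0` margin plus charged-level drops.
Nothing here bears on the truth of RH.
-/

namespace RhW08.QuadW

open Finset

/-- ★ LATERAL MOTION IS PAID BY HEIGHT² along a nested chain. -/
theorem lateral_sq_sum_le (v : ℕ → ℂ) (K : ℕ) (hn : ∀ k < K, NestedStep (v k) (v (k + 1))) :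
    (∑ k ∈ range K, ((v (k + 1)).re - (v k).re) ^ 2) + (v K).im ^ 2 ≤ (v 0).im ^ 2 := by
  induction K with
  | zero => simp
  | succ K ih =>
    have hK : NestedStep (v K) (v (K + 1)) := hn K (Nat.lt_succ_self K)
    have ih' := ih (fun k hk => hn k (Nat.lt_succ_of_lt hk))
    unfold NestedStep at hK
    rw [sum_range_succ]
    linarith

/-- Corollary: total squared lateral displacement of a nested lineage born at height `≤ Hs` is `≤ Hs²`. -/
theorem lateral_sq_sum_le_sq (v : ℕ → ℂ) (K : ℕ) {Hs : ℝ} (h0 : 0 ≤ (v 0).im) (hHs : (v 0).im ≤ Hs)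
    (hn : ∀ k < K, NestedStep (v k) (v (k + 1))) :
    (∑ k ∈ range K, ((v (k + 1)).re - (v k).re) ^ 2) ≤ Hs ^ 2 := by
  have h := lateral_sq_sum_le v K hn
  nlinarith [sq_nonneg ((v K).im), h0, hHs]

/-- ★ THE LATERAL METER: the levels of a nested lineage with a lateral step `≥ s` number at most `(Im v₀ / s)²`:
`s² · #{k < K : s ≤ |Re v_{k+1} − Re v_k|} ≤ (Im v₀)²`. -/
theorem card_big_steps_le (v : ℕ → ℂ) (K : ℕ) {s : ℝ} (hs : 0 ≤ s) (hn : ∀ k < K, NestedStep (v k) (v (k + 1))) :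
    s ^ 2 * (((range K).filter (fun k => s ≤ |(v (k + 1)).re - (v k).re|)).card : ℝ) ≤ (v 0).im ^ 2 := by
  classical
  have h := lateral_sq_sum_le v K hn
  have hsub : s ^ 2 * (((range K).filter (fun k => s ≤ |(v (k + 1)).re - (v k).re|)).card : ℝ)
      ≤ ∑ k ∈ (range K).filter (fun k => s ≤ |(v (k + 1)).re - (v k).re|), ((v (k + 1)).re - (v k).re) ^ 2 := by
    rw [mul_comm, ← nsmul_eq_mul, ← sum_const]
    apply sum_le_sum
    intro k hk
    rw [mem_filter] at hk
    have hk2 := hk.2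
    have habs : s ^ 2 ≤ |(v (k + 1)).re - (v k).re| ^ 2 := pow_le_pow_left₀ hs hk2 2
    rw [sq_abs] at habs
    simpa using habs
  have hle : ∑ k ∈ (range K).filter (fun k => s ≤ |(v (k + 1)).re - (v k).re|), ((v (k + 1)).re - (v k).re) ^ 2
      ≤ ∑ k ∈ range K, ((v (k + 1)).re - (v k).re) ^ 2 :=
    sum_le_sum_of_subset_of_nonneg (filter_subset _ _) (fun _ _ _ => sq_nonneg _)
  nlinarith [sq_nonneg ((v K).im)]

end RhW08.QuadW
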